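import Mathlib
import Summits.Ventures.PercRepro2.Defs
import Summits.Ventures.PercRepro2.Independence
import Summits.Ventures.PercRepro2.Harris
import Summits.Ventures.PercRepro2.Graph
import Summits.Ventures.PercRepro2.Exploration
import Summits.Ventures.PercRepro2.Events
import Summits.Ventures.PercRepro2.Statements
import Summits.Ventures.PercRepro2.FourFunctions
import Summits.Ventures.PercRepro2.Induced
import Summits.Ventures.PercRepro2.Frontier
import Summits.Ventures.PercRepro2.ObsIndependence
import Summits.Ventures.PercRepro2.BHK
import Summits.Ventures.PercRepro2.BHKEvents
import Summits.Ventures.PercRepro2.ClusterProperty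
import Summits.Ventures.PercRepro2.BHKPair

/-!
# Increasing cluster properties of `s` are positively associated given that the cluster of `t`
avoids a set containing `s` (blind cell PercRepro2, mine-1 g38; proofs/MINE1-PAIRTP2.md §2, Case B)

For monotone cluster properties `f, f'` of `s` with values in `[0, 1]` and a vertex set `X ∋ s`,
with `A = {t ↮ x for all x ∈ X}` (the cluster of `t` avoids `X`):

  `E[f(s) 1_A] · E[f'(s) 1_A] ≤ E[f(s) f'(s) 1_A] · P(A)`.

Proof (the whole-cluster step of the cell's lens, with the roles of `s` and `t` exchanged):
explore the cluster of `t`; on `{t ↮ s}` the cluster of `s` is its cluster in `G ∖ C_t`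
(`expect_mul_eq_expect_delExpect`), so `E[f(s) 1_A] = E[1_A · g(C_t)]` with
`g(C) = E[f(s) in G ∖ C]` (`delExpect`); in `G ∖ C` the observables are increasing in the
configuration, so Harris gives `g_{ff'} ≥ g_f g_{f'}` pointwise; and `g_f, g_{f'}` are decreasing
functionals of `C_t`, so BHK06 Thm 1.1 with the avoided set `X` (`bhk_induced`, `X = Y`) gives
positive association of `1 − g_f, 1 − g_{f'}` under `1_A`, which is the claim.

The instance `f = 1{u ∈ C_s}`, `f' = 1{v ∈ C_s}`, `X = {s, u, v}` is the minor (i) of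
MINE1-PAIRTP2.md: the indicators of `u ∈ C_s` and `v ∈ C_s` are positively correlated given
`C_t ∩ {s, u, v} = ∅` (`pa_given_avoid_conn`), one of the two surviving minors of the two-vertex
status law when `(u, v)` is not linkable.
-/

namespace Summit.Ventures.PercRepro2

namespace CondAvoid

open Finset

variable {V : Type*} {E : Type*} [Fintype E] [DecidableEq E] [Fintype V] [DecidableEq V]
  {R : Type*} [Field R] [LinearOrder R] [IsStrictOrderedRing R]

/-- The avoidance event `{t ↮ x for all x ∈ X}`: the cluster of `t` misses `X`. -/
def avoidEvent (ends : E → Sym2 V) (t : V) (X : Finset V) : Set (Config E) :=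
  {ω | ∀ x ∈ X, ¬ Conn ends ω t x}

omit [Fintype E] [DecidableEq E] [DecidableEq V] in
/-- On the full vertex set the `R`-event of `BHK.lean` is the avoidance event. -/
lemma REvent_univ (ends : E → Sym2 V) (t : V) (X : Finset V) :
    REvent ends Finset.univ t X = avoidEvent ends t X := by
  ext ω
  simp only [mem_REvent, Finset.coe_univ, induced_univ, avoidEvent, Set.mem_setOf_eq]

omit [Fintype E] [DecidableEq E] [Fintype V] [DecidableEq V] [LinearOrder R] [IsStrictOrderedRing R] in
/-- The avoidance indicator as a functional of the cluster of `t` times the indicator of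
`{t ↮ s}` (for `s ∈ X`). -/
lemma indicator_avoidEvent_eq (ends : E → Sym2 V) (t : V) {X : Finset V} {s : V} (hs : s ∈ X)
    (ω : Config E) :
    (avoidEvent ends t X).indicator (1 : Config E → R) ω =
      ({C : Set V | ∀ x ∈ X, x ∉ C}.indicator 1 (cluster ends ω t)) *
        ((connEvent ends t s)ᶜ).indicator 1 ω := by
  by_cases h : ω ∈ avoidEvent ends t X
  · rw [Set.indicator_of_mem h]
    have h1 : cluster ends ω t ∈ {C : Set V | ∀ x ∈ X, x ∉ C} := fun x hx => h x hx
    have h2 : ω ∈ (connEvent ends t s)ᶜ := h s hs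
    rw [Set.indicator_of_mem h1, Set.indicator_of_mem h2]
    simp
  · rw [Set.indicator_of_notMem h]
    have h1 : cluster ends ω t ∉ {C : Set V | ∀ x ∈ X, x ∉ C} := fun h' => h fun x hx => h' x hx
    rw [Set.indicator_of_notMem h1, zero_mul]

omit [Fintype E] [DecidableEq E] [Fintype V] [DecidableEq V] in
/-- The product of two nonnegative monotone cluster properties is a monotone cluster property. -/
lemma isMonotoneClusterProperty_mul {ends : E → Sym2 V} {f f' : V → Config E → R}
    (hf : IsMonotoneClusterProperty ends f) (hf' : IsMonotoneClusterProperty ends f')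
    (hf0 : ∀ v ω, 0 ≤ f v ω) (hf'0 : ∀ v ω, 0 ≤ f' v ω) :
    IsMonotoneClusterProperty ends (fun v ω => f v ω * f' v ω) where
  mono v ω ξ h := mul_le_mul (hf.mono v ω ξ h) (hf'.mono v ω ξ h) (hf'0 v ω) (hf0 v ξ)
  eq_of_openAdj v w ω h := by rw [hf.eq_of_openAdj v w ω h, hf'.eq_of_openAdj v w ω h]

omit [Fintype E] [DecidableEq E] [Fintype V] [DecidableEq V] [Field R] [IsStrictOrderedRing R] in
/-- The observable `ω ↦ f s (delConfig W ω)` is monotone in the configuration. -/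
lemma monotone_delConfig_comp (ends : E → Sym2 V) {f : V → Config E → R}
    (hf : IsMonotoneClusterProperty ends f) (s : V) (W : Set V) :
    Monotone (fun ω : Config E => f s (delConfig ends W ω)) := by
  intro ω ω' h
  exact hf.mono s _ _ (cluster_mono (BHKPair.delConfig_mono_config ends W h) s)

omit [Fintype V] [DecidableEq V] in
/-- **Harris in `G ∖ W`**: `delExpect` of a product dominates the product of the `delExpect`s. -/
lemma delExpect_mul_le_delExpect_mul {p : E → R} (hp : IsProbVec p) (ends : E → Sym2 V)
    {f f' : V → Config E → R} (hf : IsMonotoneClusterProperty ends f)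
    (hf' : IsMonotoneClusterProperty ends f') (s : V) (W : Set V) :
    delExpect p ends f s W * delExpect p ends f' s W ≤
      delExpect p ends (fun v ω => f v ω * f' v ω) s W := by
  unfold delExpect
  exact expect_mul_expect_le_expect_mul hp (monotone_delConfig_comp ends hf s W)
    (monotone_delConfig_comp ends hf' s W)

/-- **Positive association of increasing cluster properties of `s` given that the cluster of
`t` avoids a set `X ∋ s`** (BHK-type; the whole-cluster step with the roles of `s, t`
exchanged): for monotone cluster properties `f, f'` with values in `[0, 1]`,
`E[f(s) 1_A] · E[f'(s) 1_A] ≤ E[f(s) f'(s) 1_A] · P(A)`, `A = {t ↮ X}`. -/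
theorem pa_given_avoid (p : E → R) (hp : IsProbVec p) (ends : E → Sym2 V) (s t : V)
    {X : Finset V} (hs : s ∈ X) {f f' : V → Config E → R}
    (hf : IsMonotoneClusterProperty ends f) (hf' : IsMonotoneClusterProperty ends f')
    (hf0 : ∀ v ω, 0 ≤ f v ω) (hf'0 : ∀ v ω, 0 ≤ f' v ω)
    (hf1 : ∀ ω, f s ω ≤ 1) (hf'1 : ∀ ω, f' s ω ≤ 1) :
    expect p (fun ω => f s ω * (avoidEvent ends t X).indicator 1 ω) *
        expect p (fun ω => f' s ω * (avoidEvent ends t X).indicator 1 ω) ≤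
      expect p (fun ω => f s ω * f' s ω * (avoidEvent ends t X).indicator 1 ω) *
        prob p (avoidEvent ends t X) := by
  classical
  -- the avoidance functional of the cluster of `t`
  set F : Set V → R := fun C => {C : Set V | ∀ x ∈ X, x ∉ C}.indicator 1 C with hF
  have hF0 : ∀ C, 0 ≤ F C := fun C => Set.indicator_nonneg (fun _ _ => zero_le_one) C
  have hF1 : ∀ C, F C ≤ 1 := fun C => by
    simp only [hF]
    by_cases h : C ∈ {C : Set V | ∀ x ∈ X, x ∉ C}
    · rw [Set.indicator_of_mem h]; exact le_rfl
    · rw [Set.indicator_of_notMem h]; exact zero_le_one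
  have hFF : ∀ C, F C * F C = F C := fun C => by
    simp only [hF]
    by_cases h : C ∈ {C : Set V | ∀ x ∈ X, x ∉ C}
    · rw [Set.indicator_of_mem h]; simp
    · rw [Set.indicator_of_notMem h]; simp
  -- the explored forms `g = delExpect`
  set g := delExpect p ends f s with hg
  set g' := delExpect p ends f' s with hg'
  set g₂ := delExpect p ends (fun v ω => f v ω * f' v ω) s with hg₂
  have hg_anti : Antitone g := delExpect_anti p hp ends hf s
  have hg'_anti : Antitone g' := delExpect_anti p hp ends hf' s
  have hg0 : ∀ C, 0 ≤ g C := delExpect_nonneg p hp ends f s (fun ω => hf0 s ω)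
  have hg'0 : ∀ C, 0 ≤ g' C := delExpect_nonneg p hp ends f' s (fun ω => hf'0 s ω)
  have hg1 : ∀ C, g C ≤ 1 := delExpect_le p hp ends f s hf1
  have hg'1 : ∀ C, g' C ≤ 1 := delExpect_le p hp ends f' s hf'1
  have hmul : ∀ C, g C * g' C ≤ g₂ C := fun C =>
    delExpect_mul_le_delExpect_mul hp ends hf hf' s C
  -- the tower identities (explore the cluster of `t`)
  have tower : ∀ {h : V → Config E → R}, IsMonotoneClusterProperty ends h →
      expect p (fun ω => h s ω * (avoidEvent ends t X).indicator 1 ω) =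
        expect p (fun ω => F (cluster ends ω t) * delExpect p ends h s (cluster ends ω t) *
          ((connEvent ends t s)ᶜ).indicator 1 ω) := by
    intro h hh
    rw [← expect_mul_eq_expect_delExpect p ends t s F hh]
    refine congrArg (expect p) (funext fun ω => ?_)
    rw [indicator_avoidEvent_eq ends t hs ω]
    simp only [hF]
    ring
  have t1 := tower hf
  have t2 := tower hf'
  have t3 := tower (isMonotoneClusterProperty_mul hf hf' hf0 hf'0)
  -- Harris in `G ∖ C_t`
  have step1 : expect p (fun ω => F (cluster ends ω t) * (g (cluster ends ω t) *
      g' (cluster ends ω t)) * ((connEvent ends t s)ᶜ).indicator 1 ω) ≤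
      expect p (fun ω => f s ω * f' s ω * (avoidEvent ends t X).indicator 1 ω) := by
    rw [t3]
    refine expect_mono hp fun ω => ?_
    have hind : 0 ≤ ((connEvent ends t s)ᶜ).indicator (1 : Config E → R) ω :=
      Set.indicator_nonneg (fun _ _ => zero_le_one) ω
    exact mul_le_mul_of_nonneg_right
      (mul_le_mul_of_nonneg_left (hmul _) (hF0 _)) hind
  -- BHK 1.1 with the avoided set `X` for the increasing functionals `F·(1 − g)`, `F·(1 − g')`
  have key := bhk_induced p hp ends t (F₁ := fun C => 1 - g C) (F₂ := fun C => 1 - g' C)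
    (fun _ _ h => sub_le_sub_left (hg_anti h) 1)
    (fun _ _ h => sub_le_sub_left (hg'_anti h) 1)
    (fun C => sub_nonneg.mpr (hg1 C)) (fun C => sub_nonneg.mpr (hg'1 C))
    Finset.univ X X (Finset.subset_univ _) (Finset.subset_univ _)
  simp only [Finset.inter_self, Finset.union_self, REvent_univ] at key
  have e : ∀ H : Set V → R, clusterObs ends Finset.univ t H * (avoidEvent ends t X).indicator 1 =
      fun ω => H (cluster ends ω t) * (avoidEvent ends t X).indicator 1 ω := by
    intro H
    funext ω
    simp only [Pi.mul_apply, clusterObs_apply, clusterIn_univ]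
  rw [e, e, e] at key
  simp only [Pi.mul_apply] at key
  -- rewrite the avoidance indicator everywhere as `F(C_t) · 1_{t ↮ s}`
  have hA : ∀ ω, (avoidEvent ends t X).indicator (1 : Config E → R) ω =
      F (cluster ends ω t) * ((connEvent ends t s)ᶜ).indicator 1 ω :=
    fun ω => indicator_avoidEvent_eq ends t hs ω
  -- abbreviations for the four expectations
  set I : Config E → R := fun ω => ((connEvent ends t s)ᶜ).indicator 1 ω with hI
  have hI0 : ∀ ω, 0 ≤ I ω := fun ω => Set.indicator_nonneg (fun _ _ => zero_le_one) ω
  set a := expect p (fun ω => F (cluster ends ω t) * I ω) with ha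
  set x := expect p (fun ω => F (cluster ends ω t) * g (cluster ends ω t) * I ω) with hx
  set x' := expect p (fun ω => F (cluster ends ω t) * g' (cluster ends ω t) * I ω) with hx'
  set y := expect p (fun ω => F (cluster ends ω t) * (g (cluster ends ω t) *
    g' (cluster ends ω t)) * I ω) with hy
  have hPA : prob p (avoidEvent ends t X) = a := by
    rw [prob_eq_expect_indicator, ha]
    refine congrArg (expect p) (funext fun ω => ?_)
    rw [hA ω]
  -- `key` in terms of `a x x' y`
  have key' : (a - x) * (a - x') ≤ (a - x - x' + y) * a := by
    have l1 : expect p (fun ω => (1 - g (cluster ends ω t)) *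
        (avoidEvent ends t X).indicator 1 ω) = a - x := by
      rw [ha, hx, ← expect_sub]
      refine congrArg (expect p) (funext fun ω => ?_)
      rw [hA ω]; simp only [hI, Pi.sub_apply]; ring
    have l2 : expect p (fun ω => (1 - g' (cluster ends ω t)) *
        (avoidEvent ends t X).indicator 1 ω) = a - x' := by
      rw [ha, hx', ← expect_sub]
      refine congrArg (expect p) (funext fun ω => ?_)
      rw [hA ω]; simp only [hI, Pi.sub_apply]; ring
    have l3 : expect p (fun ω => (1 - g (cluster ends ω t)) * (1 - g' (cluster ends ω t)) *
        (avoidEvent ends t X).indicator 1 ω) = a - x - x' + y := by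
      rw [ha, hx, hx', hy, ← expect_sub, ← expect_sub, ← expect_add]
      refine congrArg (expect p) (funext fun ω => ?_)
      rw [hA ω]; simp only [hI, Pi.sub_apply, Pi.add_apply]; ring
    rw [l1, l2, l3, hPA] at key
    exact key
  have hxy : x * x' ≤ y * a := by nlinarith [key']
  -- assemble
  have e1 : expect p (fun ω => f s ω * (avoidEvent ends t X).indicator 1 ω) = x := by
    rw [t1, hx]
  have e2 : expect p (fun ω => f' s ω * (avoidEvent ends t X).indicator 1 ω) = x' := by
    rw [t2, hx']
  rw [e1, e2, hPA]
  calc x * x' ≤ y * a := hxy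
    _ ≤ expect p (fun ω => f s ω * f' s ω * (avoidEvent ends t X).indicator 1 ω) * a := by
        refine mul_le_mul_of_nonneg_right ?_ ?_
        · rw [hy]; exact step1
        · rw [ha]
          exact expect_nonneg hp fun ω => mul_nonneg (hF0 _) (hI0 ω)

/-- **The minor (i) of MINE1-PAIRTP2.md**: the indicators of `u ∈ C_s` and `v ∈ C_s` are
positively correlated given that the cluster of `t` avoids `{s, u, v}`:
`P(u ↔ s, v ↔ s, A) · P(A) ≥ P(u ↔ s, A) · P(v ↔ s, A)`, `A = {t ↮ s, t ↮ u, t ↮ v}`. -/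
theorem pa_given_avoid_conn (p : E → R) (hp : IsProbVec p) (ends : E → Sym2 V) (s t u v : V) :
    prob p (connEvent ends s u ∩ avoidEvent ends t {s, u, v}) *
        prob p (connEvent ends s v ∩ avoidEvent ends t {s, u, v}) ≤
      prob p (connEvent ends s u ∩ connEvent ends s v ∩ avoidEvent ends t {s, u, v}) *
        prob p (avoidEvent ends t {s, u, v}) := by
  classical
  have hmono : ∀ b : V, IsMonotoneClusterProperty ends (connIndicator (R := R) ends b) := by
    intro b
    refine ⟨fun w ω ξ h => ?_, fun w w' ω h => ?_⟩
    · simp only [connIndicator]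
      by_cases hb : ω ∈ connEvent ends w b
      · have : ξ ∈ connEvent ends w b := h hb
        rw [Set.indicator_of_mem hb, Set.indicator_of_mem this]
        exact le_rfl
      · rw [Set.indicator_of_notMem hb]
        exact Set.indicator_nonneg (fun _ _ => zero_le_one) ξ
    · simp only [connIndicator]
      have hc : Conn ends ω w w' := conn_of_openAdj h
      by_cases hb : ω ∈ connEvent ends w b
      · have : ω ∈ connEvent ends w' b := conn_trans (conn_symm hc) hb
        rw [Set.indicator_of_mem hb, Set.indicator_of_mem this]
      · have : ω ∉ connEvent ends w' b := fun h' => hb (conn_trans hc h')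
        rw [Set.indicator_of_notMem hb, Set.indicator_of_notMem this]
  have h0 : ∀ b : V, ∀ w ω, 0 ≤ connIndicator (R := R) ends b w ω := fun b w ω =>
    Set.indicator_nonneg (fun _ _ => zero_le_one) ω
  have h1 : ∀ b : V, ∀ ω, connIndicator (R := R) ends b s ω ≤ 1 := fun b ω => by
    simp only [connIndicator]
    by_cases hb : ω ∈ connEvent ends s b
    · rw [Set.indicator_of_mem hb]; exact le_rfl
    · rw [Set.indicator_of_notMem hb]; exact zero_le_one
  have key := pa_given_avoid p hp ends s t (X := {s, u, v}) (by simp) (hmono u) (hmono v)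
    (h0 u) (h0 v) (h1 u) (h1 v)
  have eu : (fun ω => connIndicator (R := R) ends u s ω * (avoidEvent ends t {s, u, v}).indicator 1 ω) =
      (connEvent ends s u ∩ avoidEvent ends t {s, u, v}).indicator 1 := by
    funext ω
    simp only [connIndicator, Set.indicator_apply, Set.mem_inter_iff, Pi.one_apply]
    split_ifs <;> simp_all
  have ev : (fun ω => connIndicator (R := R) ends v s ω * (avoidEvent ends t {s, u, v}).indicator 1 ω) =
      (connEvent ends s v ∩ avoidEvent ends t {s, u, v}).indicator 1 := by
    funext ω
    simp only [connIndicator, Set.indicator_apply, Set.mem_inter_iff, Pi.one_apply]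
    split_ifs <;> simp_all
  have euv : (fun ω => connIndicator (R := R) ends u s ω * connIndicator (R := R) ends v s ω *
      (avoidEvent ends t {s, u, v}).indicator 1 ω) =
      (connEvent ends s u ∩ connEvent ends s v ∩ avoidEvent ends t {s, u, v}).indicator 1 := by
    funext ω
    simp only [connIndicator, Set.indicator_apply, Set.mem_inter_iff, Pi.one_apply]
    split_ifs <;> simp_all
  rw [eu, ev, euv, ← prob_eq_expect_indicator, ← prob_eq_expect_indicator,
    ← prob_eq_expect_indicator] at key
  exact key

end CondAvoid

end Summit.Ventures.PercRepro2
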